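import Mathlib
import Summits.NavierStokesRegularity.NavierStokesRegularity.Theorems.SwirlThresholdLadder
import HarnessLib.Audit
import HarnessLib

/-!
# SwirlDecrementCalculus — how a one-scale decrement law becomes a modulus (ROUND-14, seat nsreg-p2)

Every printed slightly-supercritical regularity criterion for axisymmetric Navier–Stokes flows at
the axis (Pan 2016 `(ln ln)^{0.028}`, Seregin 2022 `(ln ln)^{1/224}`, Chen–Tsai–Zhang 2022
Prop. 1.2 / Thm. 1.3 with `β < 1/8`, `α₀ = γ/(48+16γ)`, Lei–Ren 2024 Thm. 4 `(ln|ln r|)^μ`) is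
produced by ONE mechanism: a ONE-SCALE OSCILLATION DECREMENT for the swirl `Γ = r u^θ`,
`osc_{Q(R/4)} Γ ≤ (1 - λ(A(R))) · osc_{Q(R)} Γ`, whose size `λ` is a function of the scaled energy
`A(R)` of the drift at that scale (the DECREMENT LAW), iterated down the dyadic scales
`R_k = 4^{-k}`: `osc(R_K) ≤ osc(R_0) · exp(-Σ_{k<K} λ(A(R_k)))` (`decrement_iteration`).  The law
located in print is EXPONENTIAL, `λ(A) = ¼ exp(-C (1+A)^θ)` with `θ = 8` (Chen–Tsai–Zhang 2022,
arXiv:2201.01766, proof of Lemma 2.4 and p. 9: the decrement `λ` is admissible iff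
`N (1+A(R))^4 (-ln λ)^{-1/2} ≤ 1/2`).  This file is the real-analysis CALCULUS of that scheme
(Mathlib only, plus the R13 ladder module for the last interface theorem):

* `decrement_iteration`, `modulus_of_harmonic_minorant` (`λ_k ≥ c/(k+1)` ⇒ modulus `(K+1)^{-c}` =
  a log-power `|ln r|^{-c}`), `modulus_of_power_minorant` (`λ_k ≥ c (k+2)^{-ε}` ⇒ modulus
  `exp(-c (K+2)^{1-ε})` = Chen–Tsai–Zhang's `exp(-c|ln r|^τ)`, `τ = 1 - ε`);
* `expLaw_logGrowth_minorant`: under the exponential law with exponent `θ` and ITERATED-LOG growth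
  `A(R_k) ≤ K (ln k)^β` of the scaled energy, `βθ < 1` gives every power minorant — the printed
  thresholds are `β < 1/θ` (CTZ: `1/8`);
* `expLaw_powerGrowth_summable`: under the exponential law, LOG growth `A(R_k) ≤ K k^μ`
  (= `K |ln R|^μ`, Lei–Ren's question, Adv. Math. 457 (2024) p. 6) makes the decrements SUMMABLE for
  EVERY `μ > 0` and EVERY `θ > 0`: the scheme yields no modulus at all — no improvement of the
  exponent `θ` crosses `ln ln → ln`;
* `polyLaw_powerGrowth_harmonic`: a POLYNOMIAL law `λ = c(1+A)^{-p}` would reach `|ln R|^μ` for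
  `μ p ≤ 1` (harmonic minorant) — the dictionary «Lei–Ren's `|ln r|` = inverse-polynomial
  decrement»; the companion file `…Theorems.SwirlDecrementLaw` records that the steady BURGERS VORTEX
  refutes every polynomial law (decrement `≤ e^{-sR²/64}` at scaled energy `≍ (sR²)²`);
* `criterion_expLogPow_of_logRungs`: the output modulus `N e^{-c|ln r|^τ}` of the scheme lies under
  the Lei–Zhang 2017 rungs `C₁/(ln r)²` of the R13 axis-modulus ladder (`two_log_sub_le`), so the
  tree fact `LeiZhang2017_logModulus_regularity` turns it into regularity
  (`criterion_expLogPow_of_leiZhang`) — the last arrow of Chen–Tsai–Zhang's Thm. 1.3, by name.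

Nothing here is a statement about Navier–Stokes except through the cited R13 ladder decls; every
`theorem` is real analysis.  Memo: `run/shared/lean/pub/ns-regularity-ideate/ns-regularity-ideate-p2/ROUND-14.md`.
-/

namespace Summit.NavierStokesRegularity.NavierStokesRegularity.Theorems.SwirlDecrementCalculus

open Real Finset Filter Topology
open Summit.NavierStokesRegularity.NavierStokesRegularity.Theorems.SwirlThresholdLadder

noncomputable section

/-! ## A. Iterating one-scale decrements -/

/-- **One-scale decrements iterate to a modulus.**  If `J (k+1) ≤ (1 - δ k) · J k` with `J ≥ 0`,
then `J K ≤ J 0 · exp(-Σ_{k<K} δ k)` (from `1 - δ ≤ e^{-δ}`). -/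
theorem decrement_iteration (J δ : ℕ → ℝ) (hJ : ∀ k, 0 ≤ J k)
    (hstep : ∀ k, J (k + 1) ≤ (1 - δ k) * J k) (K : ℕ) :
    J K ≤ J 0 * Real.exp (-(∑ k ∈ Finset.range K, δ k)) := by
  induction K with
  | zero => simp
  | succ K ih =>
    have h1 : 1 - δ K ≤ Real.exp (-δ K) := by
      have := Real.add_one_le_exp (-δ K)
      linarith
    calc J (K + 1) ≤ (1 - δ K) * J K := hstep K
      _ ≤ Real.exp (-δ K) * J K := mul_le_mul_of_nonneg_right h1 (hJ K)
      _ ≤ Real.exp (-δ K) * (J 0 * Real.exp (-(∑ k ∈ Finset.range K, δ k))) :=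
          mul_le_mul_of_nonneg_left ih (Real.exp_pos _).le
      _ = J 0 * Real.exp (-(∑ k ∈ Finset.range (K + 1), δ k)) := by
          rw [Finset.sum_range_succ, neg_add, Real.exp_add]
          ring

/-! ## B. Harmonic and power minorants of the decrement sum -/

/-- `ln(k+2) - ln(k+1) ≤ 1/(k+1)` (from `ln x ≤ x - 1`). -/
theorem log_succ_sub_log_le (k : ℕ) :
    Real.log ((k : ℝ) + 2) - Real.log ((k : ℝ) + 1) ≤ 1 / ((k : ℝ) + 1) := by
  have hk1 : (0 : ℝ) < (k : ℝ) + 1 := by positivity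
  have hk2 : (0 : ℝ) < (k : ℝ) + 2 := by positivity
  rw [← Real.log_div hk2.ne' hk1.ne']
  have h := Real.log_le_sub_one_of_pos (div_pos hk2 hk1)
  have heq : ((k : ℝ) + 2) / ((k : ℝ) + 1) - 1 = 1 / ((k : ℝ) + 1) := by
    field_simp
    ring
  linarith [heq]

/-- **Power minorant**: for `0 ≤ ε`, `(K+2)^{1-ε} - 2^{1-ε} ≤ Σ_{k<K} (k+2)^{-ε}` (no concavity
needed: `(K+3)^{1-ε} - (K+2)^{1-ε} ≤ (K+2)^{-ε}` since `t ↦ t^{-ε}` is antitone). -/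
theorem rpow_sub_le_power_sum {ε : ℝ} (hε : 0 ≤ ε) (K : ℕ) :
    ((K : ℝ) + 2) ^ (1 - ε) - (2 : ℝ) ^ (1 - ε) ≤
      ∑ k ∈ Finset.range K, ((k : ℝ) + 2) ^ (-ε) := by
  induction K with
  | zero => simp
  | succ K ih =>
    rw [Finset.sum_range_succ]
    have hK2 : (0 : ℝ) < (K : ℝ) + 2 := by positivity
    have hK3 : (0 : ℝ) < (K : ℝ) + 3 := by positivity
    have hstep : ((K : ℝ) + 3) ^ (1 - ε) - ((K : ℝ) + 2) ^ (1 - ε) ≤ ((K : ℝ) + 2) ^ (-ε) := by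
      have e3 : ((K : ℝ) + 3) ^ (1 - ε) = ((K : ℝ) + 3) * ((K : ℝ) + 3) ^ (-ε) := by
        rw [sub_eq_add_neg, Real.rpow_add hK3, Real.rpow_one]
      have e2 : ((K : ℝ) + 2) ^ (1 - ε) = ((K : ℝ) + 2) * ((K : ℝ) + 2) ^ (-ε) := by
        rw [sub_eq_add_neg, Real.rpow_add hK2, Real.rpow_one]
      have hmono : ((K : ℝ) + 3) ^ (-ε) ≤ ((K : ℝ) + 2) ^ (-ε) :=
        Real.rpow_le_rpow_of_nonpos hK2 (by linarith) (by linarith)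
      have hnn : 0 ≤ ((K : ℝ) + 2) ^ (-ε) := Real.rpow_nonneg hK2.le _
      rw [e3, e2]
      nlinarith [mul_nonneg hK3.le (sub_nonneg.2 hmono), hnn]
    have hc : ((K + 1 : ℕ) : ℝ) + 2 = (K : ℝ) + 3 := by
      push_cast
      ring
    rw [hc]
    linarith

/-- **Harmonic minorant ⇒ log-power modulus.**  If every decrement is at least `c/(k+1)`, the
iteration gives `J K ≤ J 0 · (K+1)^{-c}`; with `K ≍ |ln r|` this is the modulus `|ln r|^{-c}`, which
feeds Wei's rung of the R13 axis-modulus ladder iff `c > 3/2` and Lei–Zhang's iff `c ≥ 2`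
(`SwirlThresholdLadder.SwirlModulusCriterion.of_logRung`). -/
theorem modulus_of_harmonic_minorant (J δ : ℕ → ℝ) (hJ : ∀ k, 0 ≤ J k)
    (hstep : ∀ k, J (k + 1) ≤ (1 - δ k) * J k) {c : ℝ} (hc : 0 ≤ c)
    (hmin : ∀ k : ℕ, c / ((k : ℝ) + 1) ≤ δ k) (K : ℕ) :
    J K ≤ J 0 * ((K : ℝ) + 1) ^ (-c) := by
  have h := decrement_iteration J δ hJ hstep K
  -- harmonic minorant `ln(K+1) ≤ Σ_{k<K} 1/(k+1)` (the tree's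
  -- `Literature.Geometry.MetricEmbeddings.log_succ_le_sum_range_inv`, re-derived inline by induction)
  have hlog : ∀ N : ℕ, Real.log ((N : ℝ) + 1) ≤ ∑ k ∈ Finset.range N, 1 / ((k : ℝ) + 1) := by
    intro N
    induction N with
    | zero => simp
    | succ N ih =>
      rw [Finset.sum_range_succ]
      have h' := log_succ_sub_log_le N
      have hc' : ((N + 1 : ℕ) : ℝ) + 1 = (N : ℝ) + 2 := by
        push_cast
        ring
      rw [hc']
      linarith
  have hsum : c * Real.log ((K : ℝ) + 1) ≤ ∑ k ∈ Finset.range K, δ k := by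
    calc c * Real.log ((K : ℝ) + 1) ≤ c * ∑ k ∈ Finset.range K, 1 / ((k : ℝ) + 1) :=
          mul_le_mul_of_nonneg_left (hlog K) hc
      _ = ∑ k ∈ Finset.range K, c / ((k : ℝ) + 1) := by
          rw [Finset.mul_sum]
          refine Finset.sum_congr rfl fun k _ => ?_
          rw [mul_one_div]
      _ ≤ ∑ k ∈ Finset.range K, δ k := Finset.sum_le_sum fun k _ => hmin k
  have hK : (0 : ℝ) < (K : ℝ) + 1 := by positivity
  calc J K ≤ J 0 * Real.exp (-(∑ k ∈ Finset.range K, δ k)) := h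
    _ ≤ J 0 * Real.exp (-(c * Real.log ((K : ℝ) + 1))) :=
        mul_le_mul_of_nonneg_left (Real.exp_le_exp.2 (neg_le_neg hsum)) (hJ 0)
    _ = J 0 * ((K : ℝ) + 1) ^ (-c) := by
        rw [Real.rpow_def_of_pos hK]
        congr 1
        congr 1
        ring

/-- **Power minorant ⇒ Hölder-log modulus.**  If every decrement is at least `c (k+2)^{-ε}`
(`0 ≤ ε`), the iteration gives `J K ≤ J 0 · e^{c 2^{1-ε}} · exp(-c (K+2)^{1-ε})`; with
`K ≍ |ln r|` this is Chen–Tsai–Zhang's modulus `N e^{-c|ln r|^τ}`, `τ = 1 - ε`. -/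
theorem modulus_of_power_minorant (J δ : ℕ → ℝ) (hJ : ∀ k, 0 ≤ J k)
    (hstep : ∀ k, J (k + 1) ≤ (1 - δ k) * J k) {c ε : ℝ} (hc : 0 ≤ c) (hε : 0 ≤ ε)
    (hmin : ∀ k : ℕ, c * ((k : ℝ) + 2) ^ (-ε) ≤ δ k) (K : ℕ) :
    J K ≤ J 0 * Real.exp (c * (2 : ℝ) ^ (1 - ε)) *
      Real.exp (-(c * ((K : ℝ) + 2) ^ (1 - ε))) := by
  have h := decrement_iteration J δ hJ hstep K
  have hsum : c * (((K : ℝ) + 2) ^ (1 - ε) - (2 : ℝ) ^ (1 - ε)) ≤ ∑ k ∈ Finset.range K, δ k := by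
    calc c * (((K : ℝ) + 2) ^ (1 - ε) - (2 : ℝ) ^ (1 - ε))
          ≤ c * ∑ k ∈ Finset.range K, ((k : ℝ) + 2) ^ (-ε) :=
          mul_le_mul_of_nonneg_left (rpow_sub_le_power_sum hε K) hc
      _ = ∑ k ∈ Finset.range K, c * ((k : ℝ) + 2) ^ (-ε) := by rw [Finset.mul_sum]
      _ ≤ ∑ k ∈ Finset.range K, δ k := Finset.sum_le_sum fun k _ => hmin k
  calc J K ≤ J 0 * Real.exp (-(∑ k ∈ Finset.range K, δ k)) := h
    _ ≤ J 0 * Real.exp (-(c * (((K : ℝ) + 2) ^ (1 - ε) - (2 : ℝ) ^ (1 - ε)))) :=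
        mul_le_mul_of_nonneg_left (Real.exp_le_exp.2 (neg_le_neg hsum)) (hJ 0)
    _ = J 0 * Real.exp (c * (2 : ℝ) ^ (1 - ε)) * Real.exp (-(c * ((K : ℝ) + 2) ^ (1 - ε))) := by
        rw [mul_assoc, ← Real.exp_add]
        congr 1
        congr 1
        ring

/-! ## C. The exponential law: which growth it tolerates -/

/-- Completing the square under `ln x ≤ x^{a/2}/(a/2)`: `2 ln x - c x^a ≤ 4/(a² c)` for `x > 0`. -/
theorem two_log_sub_le {a c x : ℝ} (ha : 0 < a) (hc : 0 < c) (hx : 0 < x) :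
    2 * Real.log x - c * x ^ a ≤ 4 / (a ^ 2 * c) := by
  have ha2 : 0 < a / 2 := by linarith
  have hlog : Real.log x ≤ x ^ (a / 2) / (a / 2) := Real.log_le_rpow_div hx.le ha2
  obtain ⟨y, hy⟩ : ∃ y : ℝ, y = x ^ (a / 2) := ⟨_, rfl⟩
  have hy0 : 0 ≤ y := by rw [hy]; exact Real.rpow_nonneg hx.le _
  have hxa : x ^ a = y ^ 2 := by
    rw [hy, ← Real.rpow_natCast, ← Real.rpow_mul hx.le]
    congr 1
    push_cast
    ring
  have h1 : 2 * Real.log x ≤ 4 * y / a := by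
    have heq : x ^ (a / 2) / (a / 2) = 4 * y / a / 2 := by
      rw [← hy]
      field_simp
      ring
    linarith [hlog, heq]
  rw [hxa]
  have key : 4 * y / a - c * y ^ 2 ≤ 4 / (a ^ 2 * c) := by
    have hsq : 0 ≤ c * (y - 2 / (a * c)) ^ 2 := by positivity
    have hexp : c * (y - 2 / (a * c)) ^ 2 = c * y ^ 2 - 4 * y / a + 4 / (a ^ 2 * c) := by
      field_simp
      ring
    linarith [hsq, hexp]
  linarith [h1, key]

/-- `exp(-c x^a) ≤ e^{4/(a²c)} · x^{-2}` for `x > 0` (so the exponential of a power is summable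
along the integers, and — with `a = τ` — Chen–Tsai–Zhang's modulus `e^{-c|ln r|^τ}` lies below
`|ln r|^{-2}` up to a constant). -/
theorem exp_neg_rpow_le {a c : ℝ} (ha : 0 < a) (hc : 0 < c) {x : ℝ} (hx : 0 < x) :
    Real.exp (-(c * x ^ a)) ≤ Real.exp (4 / (a ^ 2 * c)) * (x ^ 2)⁻¹ := by
  have h := two_log_sub_le ha hc hx
  have hx2 : (x ^ 2)⁻¹ = Real.exp (Real.log x * (-2)) := by
    rw [← Real.rpow_def_of_pos hx, Real.rpow_neg hx.le, Real.rpow_two]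
  rw [hx2, ← Real.exp_add]
  exact Real.exp_le_exp.2 (by linarith)

/-- `Σ_k exp(-c (k+1)^a) < ∞` for `a, c > 0`. -/
theorem summable_exp_neg_rpow {a c : ℝ} (ha : 0 < a) (hc : 0 < c) :
    Summable (fun k : ℕ => Real.exp (-(c * ((k : ℝ) + 1) ^ a))) := by
  have h2 : Summable (fun n : ℕ => ((n : ℝ) ^ 2)⁻¹) := Real.summable_nat_pow_inv.2 (by norm_num)
  have h3 : Summable (fun k : ℕ => (((k + 1 : ℕ) : ℝ) ^ 2)⁻¹) := (summable_nat_add_iff 1).2 h2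
  have hs : Summable (fun k : ℕ => Real.exp (4 / (a ^ 2 * c)) * ((((k : ℝ) + 1)) ^ 2)⁻¹) := by
    have := h3.mul_left (Real.exp (4 / (a ^ 2 * c)))
    simpa [Nat.cast_add, Nat.cast_one] using this
  refine Summable.of_nonneg_of_le (fun k => (Real.exp_pos _).le) (fun k => ?_) hs
  exact exp_neg_rpow_le ha hc (by positivity)

/-- **EXPONENTIAL LAW + LOG GROWTH ⇒ SUMMABLE DECREMENTS (no modulus, for every exponent).**
Under the law `λ(A) = exp(-C (1+A)^θ)` and the growth `A(R_k) ≤ K (k+1)^μ` (i.e. `A(R) ≲ |ln R|^μ`,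
Lei–Ren's question), the guaranteed decrements are summable for EVERY `μ > 0`, whatever `θ > 0`:
`Σ_k exp(-C(1 + K(k+1)^μ)^θ) < ∞`.  Hence the total decay `exp(-Σ λ_k)` stays bounded below and the
scheme proves no modulus: no finite improvement of `θ` crosses `ln ln → ln`. -/
theorem expLaw_powerGrowth_summable {θ μ C K : ℝ} (hθ : 0 < θ) (hμ : 0 < μ) (hC : 0 < C)
    (hK : 0 < K) :
    Summable (fun k : ℕ => Real.exp (-(C * (1 + K * ((k : ℝ) + 1) ^ μ) ^ θ))) := by
  have hs := summable_exp_neg_rpow (mul_pos hμ hθ) (mul_pos hC (Real.rpow_pos_of_pos hK θ))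
  refine Summable.of_nonneg_of_le (fun k => (Real.exp_pos _).le) (fun k => ?_) hs
  have hk : (0 : ℝ) < (k : ℝ) + 1 := by positivity
  have hKk : 0 ≤ K * ((k : ℝ) + 1) ^ μ := mul_nonneg hK.le (Real.rpow_nonneg hk.le _)
  apply Real.exp_le_exp.2
  have h1 : (K * ((k : ℝ) + 1) ^ μ) ^ θ ≤ (1 + K * ((k : ℝ) + 1) ^ μ) ^ θ :=
    Real.rpow_le_rpow hKk (by linarith) hθ.le
  have h2 : (K * ((k : ℝ) + 1) ^ μ) ^ θ = K ^ θ * ((k : ℝ) + 1) ^ (μ * θ) := by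
    rw [Real.mul_rpow hK.le (Real.rpow_nonneg hk.le _), ← Real.rpow_mul hk.le]
  have h3 : C * K ^ θ * ((k : ℝ) + 1) ^ (μ * θ) = C * (K * ((k : ℝ) + 1) ^ μ) ^ θ := by
    rw [h2, mul_assoc]
  rw [h3]
  linarith [mul_le_mul_of_nonneg_left h1 hC.le]

/-- **EXPONENTIAL LAW + ITERATED-LOG GROWTH BELOW THE PRODUCT THRESHOLD ⇒ EVERY POWER MINORANT.**
Under the law `λ(A) = exp(-C (1+A)^θ)` and the growth `A(R_k) ≤ K (ln(k+2))^β` (i.e.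
`A(R) ≲ (ln ln (1/R))^β`), the product condition `β θ < 1` gives, for every `ε > 0`, eventually
`λ_k ≥ (k+2)^{-ε}` — whence the Hölder-log modulus by `modulus_of_power_minorant`.  For
Chen–Tsai–Zhang `θ = 8`, and `β < 1/8` is exactly their Prop. 1.2; the admissible ITERATED-LOG POWER
is `1/θ`, and that is the only thing an improvement of `θ` buys. -/
theorem expLaw_logGrowth_minorant {θ β C K ε : ℝ} (hθ : 0 < θ) (hβ : 0 ≤ β) (hC : 0 < C)
    (hK : 0 < K) (hε : 0 < ε) (hprod : β * θ < 1) :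
    ∃ k₀ : ℕ, ∀ k : ℕ, k₀ ≤ k →
      ((k : ℝ) + 2) ^ (-ε) ≤ Real.exp (-(C * (1 + K * Real.log ((k : ℝ) + 2) ^ β) ^ θ)) := by
  have hσ : 0 < 1 - β * θ := by linarith
  have hc' : 0 < C * (1 + K) ^ θ / ε := by positivity
  refine ⟨⌈Real.exp (max 1 ((C * (1 + K) ^ θ / ε) ^ (1 - β * θ)⁻¹))⌉₊, fun k hk => ?_⟩
  have hk2 : (0 : ℝ) < (k : ℝ) + 2 := by positivity
  obtain ⟨x, hxdef⟩ : ∃ x : ℝ, x = Real.log ((k : ℝ) + 2) := ⟨_, rfl⟩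
  have hkL : Real.exp (max 1 ((C * (1 + K) ^ θ / ε) ^ (1 - β * θ)⁻¹)) ≤ (k : ℝ) + 2 := by
    have h1 : (⌈Real.exp (max 1 ((C * (1 + K) ^ θ / ε) ^ (1 - β * θ)⁻¹))⌉₊ : ℝ) ≤ (k : ℝ) := by
      exact_mod_cast hk
    linarith [Nat.le_ceil (Real.exp (max 1 ((C * (1 + K) ^ θ / ε) ^ (1 - β * θ)⁻¹)))]
  have hxL : max 1 ((C * (1 + K) ^ θ / ε) ^ (1 - β * θ)⁻¹) ≤ x := by
    have := Real.log_le_log (Real.exp_pos _) hkL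
    rwa [Real.log_exp, ← hxdef] at this
  have hx1 : 1 ≤ x := (le_max_left _ _).trans hxL
  have hx0 : 0 < x := by linarith
  have hxβ : 1 ≤ x ^ β := Real.one_le_rpow hx1 hβ
  have h1 : 1 + K * x ^ β ≤ (1 + K) * x ^ β := by nlinarith
  have h2 : (1 + K * x ^ β) ^ θ ≤ (1 + K) ^ θ * x ^ (β * θ) := by
    calc (1 + K * x ^ β) ^ θ ≤ ((1 + K) * x ^ β) ^ θ :=
          Real.rpow_le_rpow (by positivity) h1 hθ.le
      _ = (1 + K) ^ θ * x ^ (β * θ) := by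
          rw [Real.mul_rpow (by linarith) (Real.rpow_nonneg hx0.le _), ← Real.rpow_mul hx0.le]
  have h3raw : C * (1 + K) ^ θ / ε ≤ x ^ (1 - β * θ) := by
    have := Real.rpow_le_rpow (Real.rpow_nonneg hc'.le _) ((le_max_right _ _).trans hxL) hσ.le
    rwa [Real.rpow_inv_rpow hc'.le hσ.ne'] at this
  have h3 : C * (1 + K) ^ θ ≤ x ^ (1 - β * θ) * ε := (div_le_iff₀ hε).1 h3raw
  have hxx : x ^ (1 - β * θ) * x ^ (β * θ) = x := by
    rw [← Real.rpow_add hx0]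
    simp
  have h5 : C * (1 + K * x ^ β) ^ θ ≤ ε * x :=
    calc C * (1 + K * x ^ β) ^ θ ≤ C * ((1 + K) ^ θ * x ^ (β * θ)) :=
          mul_le_mul_of_nonneg_left h2 hC.le
      _ = (C * (1 + K) ^ θ) * x ^ (β * θ) := by ring
      _ ≤ (x ^ (1 - β * θ) * ε) * x ^ (β * θ) :=
          mul_le_mul_of_nonneg_right h3 (Real.rpow_nonneg hx0.le _)
      _ = ε * (x ^ (1 - β * θ) * x ^ (β * θ)) := by ring
      _ = ε * x := by rw [hxx]
  rw [Real.rpow_def_of_pos hk2, ← hxdef]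
  exact Real.exp_le_exp.2 (by linarith)

/-! ## D. What a polynomial law would have bought (the dictionary with Lei–Ren's question) -/

/-- **A POLYNOMIAL LAW REACHES THE FULL LOGARITHM.**  Under a law `λ(A) = c (1+A)^{-p}` and the
growth `A(R_k) ≤ K (k+1)^μ` (`A(R) ≲ |ln R|^μ`) with `μ p ≤ 1`, every decrement is at least
`c (1+K)^{-p}/(k+1)` — a harmonic minorant, whence a log-power modulus by
`modulus_of_harmonic_minorant`.  So Lei–Ren's `|ln r|`-question (power `μ = 1`) is, in decrement
currency, the INVERSE-LINEAR law `p = 1` with a constant matching Wei's `3/2`; the companion file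
records that the steady Burgers vortex forbids every polynomial law scale by scale. -/
theorem polyLaw_powerGrowth_harmonic {p μ c K : ℝ} (hp : 0 < p) (hμ : 0 ≤ μ) (hμp : μ * p ≤ 1)
    (hc : 0 ≤ c) (hK : 0 ≤ K) (k : ℕ) :
    c * (1 + K) ^ (-p) / ((k : ℝ) + 1) ≤ c * (1 + K * ((k : ℝ) + 1) ^ μ) ^ (-p) := by
  have hk : (1 : ℝ) ≤ (k : ℝ) + 1 := by
    have : (0 : ℝ) ≤ (k : ℝ) := Nat.cast_nonneg k
    linarith
  have hk0 : (0 : ℝ) < (k : ℝ) + 1 := by positivity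
  have hkμ : 1 ≤ ((k : ℝ) + 1) ^ μ := Real.one_le_rpow hk hμ
  have h1 : 1 + K * ((k : ℝ) + 1) ^ μ ≤ (1 + K) * ((k : ℝ) + 1) ^ μ := by nlinarith
  have hpos : 0 < 1 + K * ((k : ℝ) + 1) ^ μ := by positivity
  have h2 : ((1 + K) * ((k : ℝ) + 1) ^ μ) ^ (-p) ≤ (1 + K * ((k : ℝ) + 1) ^ μ) ^ (-p) :=
    Real.rpow_le_rpow_of_nonpos hpos h1 (by linarith)
  have h3 : ((1 + K) * ((k : ℝ) + 1) ^ μ) ^ (-p) =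
      (1 + K) ^ (-p) * ((k : ℝ) + 1) ^ (-(μ * p)) := by
    rw [Real.mul_rpow (by positivity) (by positivity), ← Real.rpow_mul hk0.le, mul_neg]
  have h4 : ((k : ℝ) + 1)⁻¹ ≤ ((k : ℝ) + 1) ^ (-(μ * p)) := by
    rw [← Real.rpow_neg_one]
    exact Real.rpow_le_rpow_of_exponent_le hk (by linarith)
  calc c * (1 + K) ^ (-p) / ((k : ℝ) + 1) = c * (1 + K) ^ (-p) * ((k : ℝ) + 1)⁻¹ := by
        rw [div_eq_mul_inv]
    _ ≤ c * (1 + K) ^ (-p) * ((k : ℝ) + 1) ^ (-(μ * p)) :=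
        mul_le_mul_of_nonneg_left h4 (by positivity)
    _ = c * ((1 + K) * ((k : ℝ) + 1) ^ μ) ^ (-p) := by rw [h3]; ring
    _ ≤ c * (1 + K * ((k : ℝ) + 1) ^ μ) ^ (-p) := mul_le_mul_of_nonneg_left h2 hc

/-! ## E. The scheme's output lies under the Lei–Zhang rungs of the R13 ladder -/

/-- For `0 < r < 1`: `N e^{-c|ln r|^τ} ≤ N e^{4/(τ²c)} · |ln r|^{-2}` (`exp_neg_rpow_le` at
`x = |ln r|`), in the `logModulus` currency of the R13 ladder. -/
theorem expLogPow_le_logModulus {N c τ : ℝ} (hN : 0 ≤ N) (hc : 0 < c) (hτ : 0 < τ) {r : ℝ}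
    (hr : 0 < r) (hr1 : r < 1) :
    N * Real.exp (-(c * |Real.log r| ^ τ)) ≤
      logModulus 2 (N * Real.exp (4 / (τ ^ 2 * c))) r := by
  have hlog : 0 < |Real.log r| := abs_pos.2 (Real.log_neg hr hr1).ne
  unfold logModulus
  have h := exp_neg_rpow_le hτ hc hlog
  rw [Real.rpow_neg hlog.le, Real.rpow_two, mul_assoc]
  exact mul_le_mul_of_nonneg_left h hN

/-- **The last arrow of Chen–Tsai–Zhang's Thm. 1.3, by name on the R13 ladder.**  If the
Lei–Zhang rungs `logModulus 2 C₁` hold for every `C₁ > 1` (tree fact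
`LeiZhang2017_logModulus_regularity`, `SwirlThresholdLadder.leiZhang_iff'`), then the scheme's
output modulus `N e^{-c|ln r|^τ}` (any `N ≥ 0`, `c, τ > 0`) is itself a rung. -/
theorem criterion_expLogPow_of_logRungs
    (h : ∀ C₁ : ℝ, 1 < C₁ → SwirlModulusCriterion (logModulus 2 C₁))
    {N c τ : ℝ} (hN : 0 ≤ N) (hc : 0 < c) (hτ : 0 < τ) :
    SwirlModulusCriterion (fun r => N * Real.exp (-(c * |Real.log r| ^ τ))) := by
  have hC : 1 < max 2 (N * Real.exp (4 / (τ ^ 2 * c))) :=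
    lt_of_lt_of_le (by norm_num) (le_max_left _ _)
  refine (h _ hC).mono ⟨1 / 2, by norm_num, fun r hr hr2 => ?_⟩
  have hr1 : r < 1 := by linarith
  calc N * Real.exp (-(c * |Real.log r| ^ τ))
      ≤ logModulus 2 (N * Real.exp (4 / (τ ^ 2 * c))) r := expLogPow_le_logModulus hN hc hτ hr hr1
    _ ≤ logModulus 2 (max 2 (N * Real.exp (4 / (τ ^ 2 * c)))) r := by
        unfold logModulus
        exact mul_le_mul_of_nonneg_right (le_max_right _ _) (Real.rpow_nonneg (abs_nonneg _) _)

/-- … hence from the tree fact itself (Lei–Zhang 2017 Cor. 1.3). -/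
theorem criterion_expLogPow_of_leiZhang (h : Literature.Analysis.FluidPDE.LeiZhang2017_logModulus_regularity)
    {N c τ : ℝ} (hN : 0 ≤ N) (hc : 0 < c) (hτ : 0 < τ) :
    SwirlModulusCriterion (fun r => N * Real.exp (-(c * |Real.log r| ^ τ))) :=
  criterion_expLogPow_of_logRungs (leiZhang_iff'.1 h) hN hc hτ

end

end Summit.NavierStokesRegularity.NavierStokesRegularity.Theorems.SwirlDecrementCalculus
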